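import Mathlib
import Summits.ResolutionOfSingularities.ResolutionOfSingularities.Theorems.WildQuotientsWildQuotientResolutionJordanFiveChartW2RangeConversion
import Summits.ResolutionOfSingularities.ResolutionOfSingularities.Theorems.WildQuotientsWildQuotientResolutionJordanFiveX0ChartTools

/-!
# RUNG V5 (`J₅`), brick `HP₀` (B): the fixedness bridge on the `μ₄`-vertex chart ring `(k[x][I₁₂t])_{(x_a³t)}`

(crux stmt-ResolutionOfSingularities-15640 `WildQuotients.WildQuotientResolution`, line `Sketch`;
chain w45c RUNG V5 β‴ `HP₀`, res-L1-w45c-plan-1 ORDER (B) OWNER 2026-08-27T14:32:04Z (default at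
14:42Z: stub-2 takes (B)); consumer = res-L1-w45c-stub-4's assembly (C) `JordanFive.brickHP0'`, which
feeds res-L1-w45c-lead-1's (A1) `exists_ringEquiv_blowupChart0_weightZero` (p538056), this bridge, the
X0 model `exists_ringBrick_X0_model` (p537855), stub-5's seam `exists_sectionsEquiv_chart0_appLE` +
`ringBrick_transport₂` (p536366) and stub-4's `Quarter1123.blowup_regular_mulColon` into H₀′.
[OURS · L1 W4.5c] — assembly of landed decls; NOT a statement of any manuscript. Prover
res-L1-w45c-stub-2. Def-free.)

* `JordanFive.chart0_fixed_iff_of_intertwines` — res-L1-w45c-lead-1's GENERIC range conversion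
  `BlowupExit.map_away_fixed_iff_of_intertwines` (…ChartW2RangeConversion, p538xxx) at the chart-`0`
  section `s₀ = x_a³·t` (degree `1`, coefficient `x_a³ = gens12 0`, `σ`-invariant): for the seam's
  graded family `φ` (coefficient law `hφ`, powers clause `hP`) and ANY injective ring model
  `e' : B₀ → U` with `e' (x_a³/1)` a non-zero-divisor and `Σ : U → U` intertwining `σ`:
  `(∀ g, HomogeneousLocalization.map (φ g) _ y = y) ↔ Σ (e' y) = e' y`.
* **`JordanFive.chart0_seamFixed_iff`** — the letters of the ORDER: `eE : B₀ ≃+* ↥E` onto a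
  subalgebra `E ⊆ k[x]` (the weight-`0` model of (A1)) with `eE (F/1) = ψ₀ F` (`ψ₀` = the root
  substitution `x_a ↦ ρ⁴, x_b ↦ ρ³y₁, x_c ↦ ρ²y₂, x_d ↦ ρy₃`), the root-chart automorphism `σ_U` with
  `ψ₀ ∘ σ = σ_U ∘ ψ₀` (`JordanFive.aeval_root5_comp_eq`, p537251):
  `σ_U (eE y) = eE y ↔ ∀ g, HomogeneousLocalization.map (φ g) (hP g) y = y`.
-/

-- single-problem summit: the doubled namespace component `ResolutionOfSingularities` is forced
set_option linter.dupNamespace false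

noncomputable section

open MvPolynomial Polynomial HomogeneousLocalization Literature.AlgebraicGeometry.Resolution

namespace Summit.ResolutionOfSingularities.ResolutionOfSingularities.Theorems.WildQuotientResolution.JordanFive

variable (k : Type) [Field k] (n : ℕ) (a b c d : Fin n)

/-- The chart-`0` section `s₀ = x_a³·t`. -/
local notation3 "s₀" => (reesT (gens12 k n a b c d 0) (gens12_mem_I12 k n a b c d 0))
/-- The chart ring `B₀ = (k[x][I₁₂t])_{(x_a³t)}`. -/
local notation3 "B₀" => HomogeneousLocalization.Away (reesGrading (I12 k n a b c d)) s₀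
/-- The base map `F ↦ F/1`. -/
local notation3 "base₀" => ((HomogeneousLocalization.fromZeroRingHom (reesGrading (I12 k n a b c d))
    (.powers s₀)).comp (reesGrading.zeroRingHom (I12 k n a b c d)))
/-- The root substitution `ψ₀` of the `μ₄`-vertex chart. -/
local notation3 "root5" => (fun i : Fin n => if i = a then X a ^ 4 else if i = b then X a ^ 3 * X b
    else if i = c then X a ^ 2 * X c else if i = d then X a * X d else (X i : MvPolynomial (Fin n) k))

/-- **(B), ring-model form.** On `B₀`, for the seam's graded family `φ` and ANY injective ring model
`e' : B₀ → U` with `e' (x_a³/1)` a non-zero-divisor and a ring map `Σ : U → U` with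
`Σ (e' (F/1)) = e' ((σ F)/1)` (`σ x_a = x_a`):
`(∀ g, HomogeneousLocalization.map (φ g) _ y = y) ↔ Σ (e' y) = e' y`.
[OURS · L1 W4.5c] [folklore; assembly of landed decls] -/
theorem chart0_fixed_iff_of_intertwines
    (σ : MvPolynomial (Fin n) k ≃ₐ[k] MvPolynomial (Fin n) k) [Finite ↥(Subgroup.zpowers σ)]
    (ha : σ (X a) = X a)
    (φ : ↥(Subgroup.zpowers σ) → (reesGrading (I12 k n a b c d) →+*ᵍ reesGrading (I12 k n a b c d)))
    (hφ : ∀ (g : ↥(Subgroup.zpowers σ)) x, ((φ g x : reesAlgebra (I12 k n a b c d)) :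
        (MvPolynomial (Fin n) k)[X]) =
      (x : (MvPolynomial (Fin n) k)[X]).map ((MulSemiringAction.toRingEquiv
        (↥(Subgroup.zpowers σ)) (MvPolynomial (Fin n) k) g⁻¹ : _ ≃+* _) : _ →+* _))
    (hP : ∀ g, Submonoid.powers s₀ ≤ (Submonoid.powers s₀).comap (φ g))
    {U : Type*} [CommRing U] (e' : B₀ →+* U) (he' : Function.Injective e')
    (hnzd : e' (base₀ (gens12 k n a b c d 0)) ∈ nonZeroDivisors U)
    (Sg : U →+* U) (hSg : ∀ F, Sg (e' (base₀ F)) = e' (base₀ (σ F))) (y : B₀) :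
    (∀ g, HomogeneousLocalization.map (φ g) (hP g) y = y) ↔ Sg (e' y) = e' y := by
  have hw : σ (gens12 k n a b c d 0) = gens12 k n a b c d 0 := by
    change σ (X a ^ 3) = X a ^ 3
    rw [map_pow, ha]
  exact BlowupExit.map_away_fixed_iff_of_intertwines σ s₀ (reesT_mem _ _) _ (coe_reesT _ _) hw φ hφ
    hP e' he' hnzd Sg hSg y

/-- **(B) `JordanFive.chart0_seamFixed_iff`, in the letters of the ORDER** (plan-1 14:32:04Z): for
`eE : B₀ ≃+* ↥E` onto a subalgebra `E ⊆ k[x]` with `eE (F/1) = ψ₀ F` and a root-chart automorphism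
`σ_U` with `ψ₀ ∘ σ = σ_U ∘ ψ₀` (`σ x_a = x_a`):
`σ_U (eE y) = eE y ↔ ∀ g, HomogeneousLocalization.map (φ g) (hP g) y = y`. [OURS · L1 W4.5c]
[folklore; assembly of landed decls] -/
theorem chart0_seamFixed_iff
    (σ : MvPolynomial (Fin n) k ≃ₐ[k] MvPolynomial (Fin n) k) [Finite ↥(Subgroup.zpowers σ)]
    (ha : σ (X a) = X a)
    (φ : ↥(Subgroup.zpowers σ) → (reesGrading (I12 k n a b c d) →+*ᵍ reesGrading (I12 k n a b c d)))
    (hφ : ∀ (g : ↥(Subgroup.zpowers σ)) x, ((φ g x : reesAlgebra (I12 k n a b c d)) :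
        (MvPolynomial (Fin n) k)[X]) =
      (x : (MvPolynomial (Fin n) k)[X]).map ((MulSemiringAction.toRingEquiv
        (↥(Subgroup.zpowers σ)) (MvPolynomial (Fin n) k) g⁻¹ : _ ≃+* _) : _ →+* _))
    (hP : ∀ g, Submonoid.powers s₀ ≤ (Submonoid.powers s₀).comap (φ g))
    (E : Subalgebra k (MvPolynomial (Fin n) k)) (eE : B₀ ≃+* ↥E)
    (hbase : ∀ F, ((eE (base₀ F) : ↥E) : MvPolynomial (Fin n) k) = MvPolynomial.aeval root5 F)
    (σU : MvPolynomial (Fin n) k ≃ₐ[k] MvPolynomial (Fin n) k)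
    (hσU : (MvPolynomial.aeval root5).comp (σ : MvPolynomial (Fin n) k →ₐ[k] MvPolynomial (Fin n) k) =
      (σU : MvPolynomial (Fin n) k →ₐ[k] MvPolynomial (Fin n) k).comp (MvPolynomial.aeval root5))
    (y : B₀) :
    σU ((eE y : ↥E) : MvPolynomial (Fin n) k) = ((eE y : ↥E) : MvPolynomial (Fin n) k) ↔
      ∀ g, HomogeneousLocalization.map (φ g) (hP g) y = y := by
  let e' : B₀ →+* MvPolynomial (Fin n) k := E.val.toRingHom.comp eE.toRingHom
  have he' : ∀ y, e' y = ((eE y : ↥E) : MvPolynomial (Fin n) k) := fun _ => rfl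
  have hinj : Function.Injective e' := Subtype.val_injective.comp eE.injective
  have hroot : ∀ F, MvPolynomial.aeval root5 (σ F) = σU (MvPolynomial.aeval root5 F) := fun F => by
    have h := congrArg (fun φ : MvPolynomial (Fin n) k →ₐ[k] MvPolynomial (Fin n) k => φ F) hσU
    simpa only [AlgHom.comp_apply, AlgEquiv.coe_toAlgHom] using h
  have hnzd : e' (base₀ (gens12 k n a b c d 0)) ∈ nonZeroDivisors (MvPolynomial (Fin n) k) := by
    refine mem_nonZeroDivisors_of_ne_zero ?_
    rw [he', hbase]
    change MvPolynomial.aeval root5 (X a ^ 3) ≠ 0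
    rw [map_pow, root5_X_a k n a b c d, ← pow_mul]
    exact pow_ne_zero _ (X_ne_zero a)
  have h := chart0_fixed_iff_of_intertwines k n a b c d σ ha φ hφ hP e' hinj hnzd
    (σU : MvPolynomial (Fin n) k →+* MvPolynomial (Fin n) k)
    (fun F => show σU (e' (base₀ F)) = e' (base₀ (σ F)) by rw [he', he', hbase, hbase, hroot]) y
  rw [he'] at h
  exact h.symm

end Summit.ResolutionOfSingularities.ResolutionOfSingularities.Theorems.WildQuotientResolution.JordanFive

end
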